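import Summits.SmoothPoincare4.SmoothPoincare4.Theorems.EntropyRungCompactShrinkerGapJensenVolumeBound
import Literature.Geometry.Lorentzian.VolumePositivity
import HarnessLib

/-!
# Route EntropyRung — crux `CompactShrinkerGap`, threshold lift (door Θ), part 1: rigidity of the Jensen floor

Scalar and rigidity lemmas behind the threshold-lift reduction of
`EntropyRungCompactShrinkerGapThresholdLift.lean` (same seat, same proposal pair):

* `cylinderMass_lt_roundMass` — `32π²√π e^{-3/2} < 96π² e^{-2}` (`Θ(S³×ℝ) = .791 < .812 = Θ(S⁴)`,
  i.e. `√π e^{1/2} < 3`): the lifted mass threshold dominates the crux's;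
* `eq_two_of_sub_one_mul_exp_neg_eq` — the tangent line `(t−1)e^{-t} ≤ e^{-2}` of the landed Jensen
  volume bound (p71839) is strict off `t = 2`;
* `helper_potentialEqTwo_of_jensenGe` — **equality in the Jensen bound forces `f ≡ 2`**: for a closed
  normalised 4-d gradient shrinker, `e^{-2} Vol ≤ ∫ e^{-f} dV` implies `f x = 2` for every `x`
  (`∫ f e^{-f} = 2∫ e^{-f}` makes `∫ (e^{-2} − (f−1)e^{-f}) dV ≤ 0` with a continuous non-negative
  integrand; the Riemannian measure is positive on non-empty open sets,
  `isOpenPosMeasure_riemannianMeasure`);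
* `hessian_const_four` — the Hessian of a constant function vanishes (local copy of
  `PseudoRiemannianMetric.hessian_const` of `Lorentzian/BlackHoles.lean`, whose import is spared).

References: H.-D. Cao, R. S. Hamilton, T. Ilmanen, arXiv:math/0404165 §4 [CaoHamiltonIlmanen2004];
J. Carrillo, L. Ni, Comm. Anal. Geom. 17 (2009) §4 [CarrilloNi2009]; B. O'Neill, Semi-Riemannian
geometry (1983), Ch. 3 Def. 3.48 [ONeill1983].
-/

-- the registered namespace `Summit.SmoothPoincare4.SmoothPoincare4.Theorems` repeats a component
set_option linter.dupNamespace false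

noncomputable section

open MeasureTheory Set Function Filter
open scoped Manifold ContDiff Topology ContinuousMap

namespace Summit.SmoothPoincare4.SmoothPoincare4.Theorems

open Literature.Geometry Literature.Geometry.Lorentzian Literature.Geometry.Riemannian
  Literature.Geometry.Lorentzian.PseudoRiemannianMetric

/-! ## Scalar lemmas -/

/-- **The lifted threshold dominates the cylinder threshold**: `32π²√π e^{-3/2} < 96π² e^{-2}`,
i.e. `Θ(S³×ℝ) = 2√π e^{-3/2} < 6e^{-2} = Θ(S⁴)` (`.791 < .812`), equivalently `√π e^{1/2} < 3`
(`πe < 9`). [cite: CaoHamiltonIlmanen2004, §4] -/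
theorem cylinderMass_lt_roundMass :
    32 * Real.pi ^ 2 * Real.sqrt Real.pi * Real.exp (-(3 : ℝ) / 2) <
      96 * Real.pi ^ 2 * Real.exp (-2) := by
  have hs : Real.sqrt Real.pi < 1.7725 := by
    rw [Real.sqrt_lt' (by norm_num)]
    have := Real.pi_lt_d4
    nlinarith
  have ht : Real.exp (1 / 2) < 1.6488 := by
    have h : Real.exp (1 / 2) ^ 2 < (1.6488 : ℝ) ^ 2 := by
      rw [← Real.exp_nat_mul]
      norm_num
      have := Real.exp_one_lt_d9
      linarith
    exact lt_of_pow_lt_pow_left₀ 2 (by norm_num) h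
  have hprod : Real.sqrt Real.pi * Real.exp (1 / 2) < 3 := by
    calc Real.sqrt Real.pi * Real.exp (1 / 2) < 1.7725 * 1.6488 :=
          mul_lt_mul'' hs ht (Real.sqrt_nonneg _) (Real.exp_pos _).le
      _ < 3 := by norm_num
  have hpi : 0 < 32 * Real.pi ^ 2 := by positivity
  have he : Real.exp (-(3 : ℝ) / 2) = Real.exp (1 / 2) * Real.exp (-2) := by
    rw [← Real.exp_add]
    norm_num
  rw [he]
  have h2 : 0 < Real.exp (-2) := Real.exp_pos _
  nlinarith [mul_lt_mul_of_pos_right hprod (mul_pos hpi h2)]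

/-- **Strict tangent line**: `(t − 1) e^{-t} = e^{-2}` only at `t = 2` (the tangent-line inequality
`(t−1)e^{-t} ≤ e^{-2}` of the Jensen volume bound is strict off `t = 2`, by `x + 1 < eˣ` for
`x ≠ 0`). [folklore] -/
theorem eq_two_of_sub_one_mul_exp_neg_eq {t : ℝ} (h : (t - 1) * Real.exp (-t) = Real.exp (-2)) :
    t = 2 := by
  by_contra hne
  have h1 : t - 2 + 1 < Real.exp (t - 2) := Real.add_one_lt_exp (sub_ne_zero.2 hne)
  have h2 : 0 < Real.exp (-t) := Real.exp_pos _
  have h3 : (t - 1) * Real.exp (-t) < Real.exp (t - 2) * Real.exp (-t) := by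
    apply mul_lt_mul_of_pos_right _ h2
    linarith
  rw [← Real.exp_add, show t - 2 + -t = -2 by ring] at h3
  exact absurd h h3.ne

/-! ## The Hessian of a constant (local copy) -/

section HessianConst

variable {E : Type*} [NormedAddCommGroup E] [NormedSpace ℝ E] {H : Type*} [TopologicalSpace H]
  {I : ModelWithCorners ℝ E H} {N : Type*} [TopologicalSpace N] [ChartedSpace H N]
  [IsManifold I ∞ N] {n : ℕ∞ω} (g : PseudoRiemannianMetric I n E (TangentSpace I : N → Type _))
  [g.HasLeviCivita]

omit [IsManifold I ∞ N] in
/-- The differential (`mvfderiv`) of a constant function vanishes (local copy of the helper of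
`Lorentzian/BlackHoles.lean`, kept private to spare the import). [folklore] -/
private theorem mvfderiv_const_aux (c : ℝ) (x : N) : mvfderiv I (fun _ : N ↦ c) x = 0 := by
  have h0 : mfderiv I 𝓘(ℝ, ℝ) (fun _ : N ↦ c) x = 0 := mfderiv_const
  ext v
  simp [mvfderiv, h0]

/-- The bare Hessian operation of a constant vanishes (both terms of `X(Yc) − (∇_X Y)c` are
derivatives of constants; O'Neill 1983, Ch. 3, Def. 3.48) — a private copy of
`PseudoRiemannianMetric.hessian_const` of `Lorentzian/BlackHoles.lean` (not imported here).
[cite: ONeill1983, Ch. 3, Def. 3.48] -/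
private theorem hessianAux_const_aux (c : ℝ) (X Y : Π x : N, TangentSpace I x) (x : N) :
    g.hessianAux (fun _ : N ↦ c) X Y x = 0 := by
  have h1 : (fun y ↦ mvfderiv I (fun _ : N ↦ c) y (Y y)) = fun _ ↦ (0 : ℝ) := by
    funext y
    rw [mvfderiv_const_aux c y]
    rfl
  rw [PseudoRiemannianMetric.hessianAux, h1, mvfderiv_const_aux (0 : ℝ) x, mvfderiv_const_aux c x]
  simp

/-- **The Hessian of a constant function vanishes** (`Hess c = ∇(dc) = 0`; O'Neill 1983, Ch. 3,
Def. 3.48) — private copy of `PseudoRiemannianMetric.hessian_const` (`Lorentzian/BlackHoles.lean`,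
not imported here). [cite: ONeill1983, Ch. 3, Def. 3.48] -/
theorem hessian_const_four (c : ℝ) (x : N) : g.hessian (fun _ : N ↦ c) x = 0 := by
  have haux : ∀ X Y : Π x : N, TangentSpace I x, g.hessianAux (fun _ : N ↦ c) X Y x = 0 :=
    fun X Y ↦ hessianAux_const_aux g c X Y x
  unfold PseudoRiemannianMetric.hessian
  have hex : ∃ B : LinearMap.BilinForm ℝ (TangentSpace I x), ∀ X₀ Y₀ : TangentSpace I x,
      B X₀ Y₀ = g.hessianAux (fun _ : N ↦ c) (FiberBundle.extend E X₀) (FiberBundle.extend E Y₀) x :=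
    ⟨0, fun _ _ ↦ by simp [haux]⟩
  rw [dif_pos hex]
  ext X₀ Y₀
  simpa [haux] using hex.choose_spec X₀ Y₀

end HessianConst

/-! ## The rigidity of the Jensen floor: `Z = e^{-2} Vol` forces `f ≡ 2` -/

/-- **Equality in the Jensen volume bound forces `f ≡ 2`.** For a closed normalised 4-d gradient
shrinker (`Ric + Hess f = g/2`, `R + |∇f|² = f`, `f` smooth, `g` Riemannian Levi-Civita):
if `e^{-2}·Vol ≤ Z = ∫ e^{-f} dV` (the reverse of the landed Jensen bound `Z ≤ e^{-2} Vol`), then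
`f x = 2` for every `x`. Proof: `∫ f e^{-f} = 2Z` (`integral_mul_exp_neg_eq_two_mul`) makes
`∫ (e^{-2} − (f−1)e^{-f}) dV = e^{-2}Vol − Z ≤ 0`; the integrand is continuous and `≥ 0`
(`sub_one_mul_exp_neg_le_exp_neg_two`), the Riemannian measure is positive on non-empty open sets,
so the integrand vanishes identically, and `(t−1)e^{-t} = e^{-2}` only at `t = 2`.
[cite: CaoHamiltonIlmanen2004, §4] -/
theorem helper_potentialEqTwo_of_jensenGe :
    ∀ (M : Type) [TopologicalSpace M] [T2Space M] [SecondCountableTopology M]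
      [ChartedSpace (EuclideanSpace ℝ (Fin 4)) M] [IsManifold (𝓡 4) ∞ M] [CompactSpace M]
      [T3Space M] [MeasurableSpace M] [BorelSpace M]
      (g : Literature.Geometry.Lorentzian.PseudoRiemannianMetric (𝓡 4) ∞ (EuclideanSpace ℝ (Fin 4))
        (TangentSpace (𝓡 4) : M → Type _)) [g.HasLeviCivita] (f : M → ℝ) (hg : g.IsRiemannian),
      ContMDiff (𝓡 4) 𝓘(ℝ, ℝ) ∞ f →
      (∀ (x : M) (X Y : TangentSpace (𝓡 4) x),
        g.ricci x X Y + g.hessian f x X Y = (1 / 2 : ℝ) * g.val x X Y) →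
      (∀ x : M, g.scalarCurvature x + g.gradSq f x = f x) →
      Real.exp (-2) *
          ((Literature.Geometry.Lorentzian.riemannianMeasure (g.toContMDiffRiemannianMetric hg))
            Set.univ).toReal ≤
        ∫ x, Real.exp (-f x)
          ∂(Literature.Geometry.Lorentzian.riemannianMeasure (g.toContMDiffRiemannianMetric hg)) →
      ∀ x : M, f x = 2 := by
  intro M _ _ _ _ _ _ _ _ _ g _ f hg hf hsol hnorm hge
  set μ := riemannianMeasure (g.toContMDiffRiemannianMetric hg) with hμ
  have hid := integral_mul_exp_neg_eq_two_mul M g f hg hf hsol hnorm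
  haveI : IsFiniteMeasure μ :=
    ⟨riemannianVolume_lt_top_of_isCompact_holds (g.toContMDiffRiemannianMetric hg) le_rfl
      isCompact_univ⟩
  haveI : μ.IsOpenPosMeasure := isOpenPosMeasure_riemannianMeasure _
  have hV : g.riemVolume = μ := PseudoRiemannianMetric.riemVolume_eq hg
  have hfc : Continuous f := hf.continuous
  have hec : Continuous fun x ↦ Real.exp (-f x) := Real.continuous_exp.comp hfc.neg
  have hint : Integrable (fun x ↦ Real.exp (-f x)) μ := hV ▸ integrable_exp_neg_of_contMDiff hf
  have hfint : Integrable (fun x ↦ f x * Real.exp (-f x)) μ :=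
    hV ▸ g.integrable_of_continuous (hfc.mul hec)
  -- the defect integrand
  set φ : M → ℝ := fun x ↦ Real.exp (-2) - (f x - 1) * Real.exp (-f x) with hφ
  have hφc : Continuous φ := continuous_const.sub ((hfc.sub continuous_const).mul hec)
  have hφnn : ∀ x, 0 ≤ φ x := fun x ↦ sub_nonneg.2 (sub_one_mul_exp_neg_le_exp_neg_two (f x))
  have hφint : Integrable φ μ := (integrable_const _).sub ((hfint.sub hint).congr
    (ae_of_all _ fun x ↦ by simp only [Pi.sub_apply]; ring))
  have hφI : ∫ x, φ x ∂μ = Real.exp (-2) * (μ univ).toReal - ∫ x, Real.exp (-f x) ∂μ := by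
    have h1 : ∫ x, φ x ∂μ = ∫ x, Real.exp (-2) ∂μ - ∫ x, (f x - 1) * Real.exp (-f x) ∂μ := by
      rw [← integral_sub (integrable_const _)]
      · exact (hfint.sub hint).congr (ae_of_all _ fun x ↦ by simp only [Pi.sub_apply]; ring)
    have h2 : ∫ x, (f x - 1) * Real.exp (-f x) ∂μ = ∫ x, Real.exp (-f x) ∂μ := by
      have : (fun x ↦ (f x - 1) * Real.exp (-f x)) =
          fun x ↦ f x * Real.exp (-f x) - Real.exp (-f x) := by
        funext x; ring
      rw [this, integral_sub hfint hint, hid]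
      ring
    rw [h1, h2, integral_const, smul_eq_mul, Measure.real]
    ring
  have hφ0 : ∫ x, φ x ∂μ = 0 := by
    apply le_antisymm
    · rw [hφI]; linarith
    · exact integral_nonneg hφnn
  have hae : φ =ᵐ[μ] 0 := (integral_eq_zero_iff_of_nonneg_ae (ae_of_all _ hφnn) hφint).1 hφ0
  have hzero : φ = 0 := (hφc.ae_eq_iff_eq μ continuous_const).1 hae
  intro x
  have hx : φ x = 0 := by simpa using congrFun hzero x
  have hx' : (f x - 1) * Real.exp (-f x) = Real.exp (-2) := by
    simp only [hφ] at hx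
    linarith
  exact eq_two_of_sub_one_mul_exp_neg_eq hx'

end Summit.SmoothPoincare4.SmoothPoincare4.Theorems

end
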